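import Literature.AlgebraicGeometry.Resolution.TameCyclicFixedRing
import Mathlib.RingTheory.Finiteness.Ideal
import HarnessLib

/-!
# Monomial structure of a regular local ring over the invariants of a diagonal tame cyclic action

Topic: `Literature/AlgebraicGeometry/Resolution`. PROOF side of `CossartPiltant2019ReductionP`
(`ArithmeticalThreefoldsLocal.lean`), sixth brick of its one remaining input (C4) — descent of
local uniformization below the ramification field ([CoP1] Props. 9.3/9.5 with Lemma 9.4). By
[CoP1] Prop. 6.2 (2) the tame part `H = Gⁱ/Gʳ` acts on the completed local model
`R̂ʳ ≃ κ(Rⁱ)[[x₁, …, x_n]]/I` through a DIAGONAL linear action on a regular system of parameters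
("`h.xⱼ = χⱼ(h) xⱼ` … i.e. the action is diagonal on `R̂ʳ`", (30)), and the proof of Lemma 9.4
computes the invariants of such an action monomially: "`Ŝ₁^G = (Ŝ₁)^G = κ(S₁)[[z₁^l, z₂, z₃]]`"
(HAL p. 29) — the pseudo-reflection case, formalised without completion in
`TameCyclicInvariants.lean` / `TameCyclicFixedRing.lean`. This file proves the GENERAL diagonal
case (arbitrary characters `tⱼ`), again algebraically: for a Noetherian local ring `B` with a tame
cyclic residually trivial automorphism `σ` and generators `x₁, …, x_d` of `𝔪_B` that are
eigenvectors, `σ xⱼ = ζ^{tⱼ} xⱼ`, and `A = B^σ` the fixed subring,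

* `span_monomials_eq_top_of_eigen` — PROVED: `B = ∑_{v ∈ [0,ℓ)^d} A·x^v` (the monomials
  `x^v = ∏ xⱼ^{vⱼ}` with exponents `< ℓ` generate `B` as an `A`-module): `B = A + 𝔪_B`, so
  `B = ∑_{v ∈ [0,N)^d} A x^v + 𝔪_B^N`; `𝔪_B^N ⊆ (x₁^ℓ, …, x_d^ℓ) B ⊆ 𝔪_A B` for `N ≫ 0`; Nakayama
  over the Noetherian local ring `A` (`TameCyclicFixedRing.lean`); `x^v ∈ A · x^{v mod ℓ}`.
* `eigen_mem_span_monomials` — PROVED: a weight-`k` eigenvector (`σ b = ζ^k b`) lies in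
  `∑_{v ∈ [0,ℓ)^d, t·v ≡ k} A x^v` (apply the twisted Reynolds operator `P_k`: `P_k x^v = ℓ x^v` or
  `0` according as `t·v ≡ k (mod ℓ)` or not).
* `maximalIdeal_fixedSubring_eq_span_monomials` — PROVED: `𝔪_A` is generated by the INVARIANT
  MONOMIALS `x^w`, `0 ≠ w ∈ [0,ℓ]^d`, `t·w ≡ 0 (mod ℓ)` — the monomial (toric) structure of the
  ring of invariants behind the toric resolution of the quotient in [CoP1] Lemma 9.4 (53)–(54).

Everything is PROVED; no named facts are introduced.

## Sources

* V. Cossart, O. Piltant, *Resolution of singularities of threefolds in positive characteristic.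
  I*, J. Algebra 320 (2008) 1051–1082: Prop. 6.2 (2) with (28)–(30), and proof of Lemma 9.4,
  (53)–(54) (HAL hal-00139124, pp. 17–19 and 28–29). [CossartPiltant2008]
-/

noncomputable section

open IsLocalRing

namespace Literature.AlgebraicGeometry.Resolution

universe u

section Monomial

variable {B : Type u} [CommRing B] (σ : B ≃+* B)

/-! ## Reynolds engine (private; cf. `TameCyclicFixedRing.lean`) -/

/-- `σⁱ e = ζ^{ki} e` for an eigenvector `e` of weight `k`. [folklore] -/
private theorem pow_apply_eigen' {ζ e : B} (hσζ : σ ζ = ζ) {k : ℕ} (he : σ e = ζ ^ k * e) (i : ℕ) :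
    (σ ^ i) e = ζ ^ (k * i) * e := by
  induction i with
  | zero => simp
  | succ i ih =>
    rw [pow_succ', RingAut.mul_apply, ih, map_mul, map_pow, hσζ, he, ← mul_assoc, ← pow_add,
      show k * i + k = k * (i + 1) by ring]

/-- `σ (P₀ b) = P₀ b` when `σ^ℓ = 1`. [folklore] -/
private theorem apply_sum_pow_apply' {ℓ : ℕ} (hℓ0 : ℓ ≠ 0) (hσℓ : σ ^ ℓ = 1) (b : B) :
    σ (∑ i ∈ Finset.range ℓ, (σ ^ i) b) = ∑ i ∈ Finset.range ℓ, (σ ^ i) b := by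
  rw [map_sum]
  let f : ℕ → B := fun i => (σ ^ i) b
  have hf : ∀ i, σ ((σ ^ i) b) = f (i + 1) := fun i => by
    change σ ((σ ^ i) b) = (σ ^ (i + 1)) b
    rw [pow_succ', RingAut.mul_apply]
  simp only [hf]
  have hfℓ : f ℓ = f 0 := by
    change (σ ^ ℓ) b = (σ ^ 0) b
    rw [hσℓ, pow_zero]
  obtain ⟨m, hm⟩ : ∃ m, ℓ = m + 1 := ⟨ℓ - 1, by omega⟩
  rw [hm, Finset.sum_range_succ' f, Finset.sum_range_succ (fun x => f (x + 1)), ← hm, hfℓ]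

/-- The twisted Reynolds operator on an eigenvector of weight `m`:
`P_k e = (∑ᵢ (η^k ζ^m)ⁱ) e`. [folklore] -/
private theorem twistedSum_eigen {ℓ : ℕ} {ζ η e : B} (hσζ : σ ζ = ζ) {m : ℕ}
    (he : σ e = ζ ^ m * e) (k : ℕ) :
    (∑ i ∈ Finset.range ℓ, η ^ (k * i) * (σ ^ i) e) =
      (∑ i ∈ Finset.range ℓ, (η ^ k * ζ ^ m) ^ i) * e := by
  rw [Finset.sum_mul]
  refine Finset.sum_congr rfl fun i _ => ?_
  rw [pow_apply_eigen' σ hσζ he i, ← mul_assoc, mul_pow, ← pow_mul, ← pow_mul]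

/-- The character sum `∑ᵢ (η^k ζ^m)ⁱ` is `ℓ` if `m ≡ k (mod ℓ)` and `0` otherwise (`η = ζ⁻¹`,
`ζ^r − 1` a unit for `0 < r < ℓ`). [folklore] -/
private theorem charSum_eq {ℓ : ℕ} (hℓ0 : ℓ ≠ 0) {ζ η : B} (hηζ : η * ζ = 1) (hζℓ : ζ ^ ℓ = 1)
    (hζu : ∀ r : ℕ, 0 < r → r < ℓ → IsUnit (ζ ^ r - 1)) (k m : ℕ) :
    (∑ i ∈ Finset.range ℓ, (η ^ k * ζ ^ m) ^ i) = if m % ℓ = k % ℓ then (ℓ : B) else 0 := by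
  have hℓpos : 0 < ℓ := Nat.pos_of_ne_zero hℓ0
  have hηℓ : η ^ ℓ = 1 := by
    have : (η * ζ) ^ ℓ = 1 := by rw [hηζ, one_pow]
    rwa [mul_pow, hζℓ, mul_one] at this
  -- reduce `η^k ζ^m` to a power of `ζ`: `η^k ζ^m = ζ^(m + (ℓ - 1) k)`
  have hη : η = ζ ^ (ℓ - 1) := by
    have h1 : ζ * ζ ^ (ℓ - 1) = 1 := by rw [← pow_succ', Nat.sub_add_cancel hℓpos, hζℓ]
    calc η = η * (ζ * ζ ^ (ℓ - 1)) := by rw [h1, mul_one]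
      _ = (η * ζ) * ζ ^ (ℓ - 1) := by ring
      _ = ζ ^ (ℓ - 1) := by rw [hηζ, one_mul]
  set c : ℕ := m + (ℓ - 1) * k with hc
  have hρ : η ^ k * ζ ^ m = ζ ^ c := by
    rw [hη, ← pow_mul, ← pow_add, hc, add_comm]
  have hζmod : ∀ n : ℕ, ζ ^ n = ζ ^ (n % ℓ) := fun n => by
    conv_lhs => rw [← Nat.mod_add_div n ℓ, pow_add, pow_mul, hζℓ, one_pow, mul_one]
  -- `c ≡ m - k`, so `c % ℓ = 0 ↔ m % ℓ = k % ℓ`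
  have hcmod : c % ℓ = 0 ↔ m % ℓ = k % ℓ := by
    have h1 : (c + k) % ℓ = m % ℓ := by
      rw [hc, show m + (ℓ - 1) * k + k = m + ℓ * k by
        rw [add_assoc, ← Nat.succ_mul, ← Nat.add_one, Nat.sub_add_cancel hℓpos], Nat.add_mul_mod_self_left]
    constructor
    · intro h0
      rw [← h1, Nat.add_mod, h0, zero_add, Nat.mod_mod]
    · intro hmk
      have h2 : (c + k) % ℓ = (0 + k) % ℓ := by rw [h1, hmk, zero_add]
      have h3 := Nat.ModEq.add_right_cancel' k h2
      simpa [Nat.ModEq] using h3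
  rw [hρ]
  split_ifs with hmk
  · have h0 : c % ℓ = 0 := hcmod.mpr hmk
    have : ζ ^ c = 1 := by rw [hζmod, h0, pow_zero]
    simp [this]
  · have h0 : c % ℓ ≠ 0 := fun h => hmk (hcmod.mp h)
    set r := c % ℓ with hr
    have hrpos : 0 < r := Nat.pos_of_ne_zero h0
    have hrℓ : r < ℓ := Nat.mod_lt _ hℓpos
    have h1 : (∑ i ∈ Finset.range ℓ, (ζ ^ r) ^ i) * (ζ ^ r - 1) = 0 := by
      rw [geom_sum_mul, ← pow_mul, mul_comm, pow_mul, hζℓ, one_pow, sub_self]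
    rw [hζmod c, ← hr]
    exact ((hζu r hrpos hrℓ).mul_left_eq_zero).mp h1

/-! ## Monomials in eigen-parameters -/

variable (A : Subring B) (hA : ∀ b : B, b ∈ A ↔ σ b = b)
  {ℓ : ℕ} (hℓ0 : ℓ ≠ 0) (hσℓ : σ ^ ℓ = 1) (hℓu : IsUnit ((ℓ : B)))
  (ζ : B) (hσζ : σ ζ = ζ) (hζℓ : ζ ^ ℓ = 1) (hζu : ∀ k : ℕ, 0 < k → k < ℓ → IsUnit (ζ ^ k - 1))
  {d : ℕ} (x : Fin d → B) (t : Fin d → ℕ) (hx : ∀ j, σ (x j) = ζ ^ (t j) * x j)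

include hx in
/-- A monomial in eigenvectors is an eigenvector, of weight `t·v`. [folklore] -/
private theorem apply_monomial (v : Fin d → ℕ) :
    σ (∏ j, x j ^ v j) = ζ ^ (∑ j, t j * v j) * ∏ j, x j ^ v j := by
  rw [map_prod]
  simp_rw [map_pow, hx, mul_pow, ← pow_mul]
  rw [Finset.prod_mul_distrib, Finset.prod_pow_eq_pow_sum]

include hA hx hζℓ in
/-- An invariant monomial (`t·v ≡ 0 mod ℓ`) lies in the fixed subring. [folklore] -/
private theorem monomial_mem_fixed_of_mod {v : Fin d → ℕ} (hv : (∑ j, t j * v j) % ℓ = 0) :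
    (∏ j, x j ^ v j) ∈ A := by
  rw [hA, apply_monomial σ ζ x t hx v]
  obtain ⟨q, hq⟩ := Nat.dvd_of_mod_eq_zero hv
  rw [hq, pow_mul, hζℓ, one_pow, one_mul]

include hA hx hζℓ in
/-- `xⱼ^ℓ` lies in the fixed subring. [folklore] -/
private theorem pow_mem_fixed (j : Fin d) : x j ^ ℓ ∈ A := by
  rw [hA, map_pow, hx, mul_pow, ← pow_mul, mul_comm (t j) ℓ, pow_mul, hζℓ, one_pow, one_mul]

include hA in
/-- Units of the fixed subring are its elements that are units of `B`. [folklore] -/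
private theorem isUnit_fixed_iff (a : A) : IsUnit a ↔ IsUnit (a : B) := by
  refine ⟨fun h => h.map A.subtype, fun h => ?_⟩
  obtain ⟨w, hw⟩ := h.exists_right_inv
  have hσw : σ w = w := by
    have h1 : (a : B) * σ w = 1 := by
      have := congrArg σ hw
      rwa [map_mul, (hA a).mp a.2, map_one] at this
    calc σ w = σ w * ((a : B) * w) := by rw [hw, mul_one]
      _ = ((a : B) * σ w) * w := by ring
      _ = w := by rw [h1, one_mul]
  exact IsUnit.of_mul_eq_one (⟨w, (hA w).mpr hσw⟩ : A) (Subtype.ext hw)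

include hA in
/-- The maximal ideal of the fixed subring is the contraction of `𝔪_B`. [folklore] -/
private theorem mem_maximalIdeal_fixed_iff [IsLocalRing B] (a : A) :
    (haveI := isLocalRing_fixedSubring σ A hA; a ∈ maximalIdeal A) ↔ (a : B) ∈ maximalIdeal B := by
  haveI := isLocalRing_fixedSubring σ A hA
  rw [IsLocalRing.mem_maximalIdeal, IsLocalRing.mem_maximalIdeal, mem_nonunits_iff,
    mem_nonunits_iff, isUnit_fixed_iff σ A hA]

/-! ## The monomial structure -/

include hA hℓ0 hσℓ hℓu hσζ hζℓ hζu hx in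
/-- **`B` is generated over the ring of invariants by the monomials `x^v`, `v ∈ [0, ℓ)^d`, in
eigen-parameters** ([CoP1] Prop. 6.2 (2): the tame group acts diagonally on a regular system of
parameters of `R̂ʳ ≃ κ[[x₁, …, x_n]]/I`; the invariant computation of Lemma 9.4, general diagonal
case, algebraic form). For a Noetherian local ring `B`, a residually trivial automorphism `σ` with
`σ^ℓ = 1`, `ℓ ∈ Bˣ`, `ζ` fixed with `ζ^ℓ = 1`, `ζ^k − 1 ∈ Bˣ` (`0 < k < ℓ`), generators
`x₁, …, x_d` of `𝔪_B` with `σ xⱼ = ζ^{tⱼ} xⱼ`, and `A = B^σ`: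
`B = ∑_{v ∈ [0,ℓ)^d} A · ∏ xⱼ^{vⱼ}`. Proof: `B = A + 𝔪_B` gives `B ⊆ ∑_{v ∈ [0,N)^d} A x^v + 𝔪_B^N`;
`𝔪_B^N ⊆ (xⱼ^ℓ) ⊆ 𝔪_A B` for `N ≫ 0`; Nakayama over `A` (Noetherian local, `B` finite:
`TameCyclicFixedRing.lean`); finally `x^v ∈ A x^{v mod ℓ}` as `xⱼ^ℓ ∈ A`.
[cite: CossartPiltant2008, Prop. 6.2 (2) (28)–(30) and proof of Lemma 9.4 (HAL pp. 19, 29)] -/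
theorem span_monomials_eq_top_of_eigen [IsLocalRing B] [IsNoetherianRing B]
    (hres : ∀ b : B, σ b - b ∈ maximalIdeal B)
    (hspan : Ideal.span (Set.range x) = maximalIdeal B) :
    Submodule.span A ((fun v : Fin d → ℕ => ∏ j, x j ^ v j) '' {v | ∀ j, v j < ℓ}) = ⊤ := by
  classical
  haveI : IsLocalRing A := isLocalRing_fixedSubring σ A hA
  haveI : IsNoetherianRing A :=
    isNoetherianRing_fixedSubring_of_tameCyclic σ A hA hℓ0 hσℓ hℓu ζ hσζ hζℓ
  haveI : Module.Finite A B :=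
    module_finite_fixedSubring_of_tameCyclic σ A hA hℓ0 hσℓ hℓu ζ hσζ hζℓ hζu
  have hℓpos : 0 < ℓ := Nat.pos_of_ne_zero hℓ0
  set mon : (Fin d → ℕ) → B := fun v => ∏ j, x j ^ v j with hmon
  have hxm : ∀ j, x j ∈ maximalIdeal B := fun j => hspan ▸ Ideal.subset_span ⟨j, rfl⟩
  -- multiplication by `xⱼ` shifts the box
  have hmul : ∀ (j : Fin d) (v : Fin d → ℕ), x j * mon v = mon (v + Pi.single j 1) := by
    intro j v
    simp only [hmon, Pi.add_apply, pow_add, Finset.prod_mul_distrib]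
    rw [mul_comm]
    congr 1
    rw [Finset.prod_eq_single j (fun i _ hij => by rw [Pi.single_eq_of_ne hij, pow_zero])
      (fun h => absurd (Finset.mem_univ j) h)]
    simp
  -- Step 1: `B ⊆ span(box N) + 𝔪_B^N`
  have hbox : ∀ (N : ℕ) (b : B), ∃ b' ∈ Submodule.span A (mon '' {v | ∀ j, v j < N}),
      b - b' ∈ maximalIdeal B ^ N := by
    intro N
    induction N with
    | zero => intro b; exact ⟨0, Submodule.zero_mem _, by simp⟩
    | succ N ih =>
      intro b
      obtain ⟨a, ha⟩ := exists_sub_mem_maximalIdeal_of_residuallyTrivial σ A hA hℓ0 hσℓ hℓu hres b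
      rw [← hspan] at ha
      obtain ⟨c, hc⟩ := (Submodule.mem_span_range_iff_exists_fun B).mp ha
      choose c' hc'mem hc'diff using fun j => ih (c j)
      refine ⟨(a : B) * mon 0 + ∑ j, x j * c' j, ?_, ?_⟩
      · refine Submodule.add_mem _ ?_ (Submodule.sum_mem _ fun j _ => ?_)
        · have h0 : mon 0 ∈ Submodule.span A (mon '' {v | ∀ j, v j < N + 1}) :=
            Submodule.subset_span ⟨0, fun j => Nat.succ_pos N, rfl⟩
          exact Submodule.smul_mem _ a h0
        · -- `xⱼ · span(box N) ⊆ span(box (N+1))`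
          have hle : (Submodule.span A (mon '' {v | ∀ j, v j < N})).map
              (LinearMap.mulLeft A (x j)) ≤ Submodule.span A (mon '' {v | ∀ j, v j < N + 1}) := by
            rw [Submodule.map_span, Submodule.span_le]
            rintro _ ⟨_, ⟨v, hv, rfl⟩, rfl⟩
            refine Submodule.subset_span ⟨v + Pi.single j 1, fun i => ?_, ?_⟩
            · by_cases hij : i = j
              · subst hij; simp only [Pi.add_apply, Pi.single_eq_same]; exact Nat.succ_lt_succ (hv i)
              · rw [Pi.add_apply, Pi.single_eq_of_ne hij, add_zero]; exact Nat.lt_succ_of_lt (hv i)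
            · exact (hmul j v).symm
          exact hle (Submodule.mem_map_of_mem (hc'mem j))
      · have h2 : b - (a : B) = ∑ j, x j * c j := by
          rw [← hc]; exact Finset.sum_congr rfl fun j _ => by rw [smul_eq_mul, mul_comm]
        have h3 : mon 0 = 1 := by simp [hmon]
        have h1 : b - ((a : B) * mon 0 + ∑ j, x j * c' j) = ∑ j, x j * (c j - c' j) := by
          calc b - ((a : B) * mon 0 + ∑ j, x j * c' j)
              = (b - (a : B)) - ∑ j, x j * c' j := by rw [h3, mul_one]; ring
            _ = ∑ j, x j * c j - ∑ j, x j * c' j := by rw [h2]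
            _ = ∑ j, x j * (c j - c' j) := by
                rw [← Finset.sum_sub_distrib]
                exact Finset.sum_congr rfl fun j _ => by ring
        rw [h1, pow_succ']
        exact Ideal.sum_mem _ fun j _ => Ideal.mul_mem_mul (hxm j) (hc'diff j)
  -- Step 2: `𝔪_B^N ⊆ (xⱼ^ℓ)` for some `N`
  let J : Ideal B := Ideal.span (Set.range fun j => x j ^ ℓ)
  obtain ⟨N, hN⟩ : ∃ N : ℕ, maximalIdeal B ^ N ≤ J := by
    refine Ideal.exists_pow_le_of_le_radical_of_fg ?_ (IsNoetherian.noetherian _)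
    rw [← hspan, Ideal.span_le]
    rintro _ ⟨j, rfl⟩
    exact ⟨ℓ, Ideal.subset_span ⟨j, rfl⟩⟩
  -- Step 3: `(xⱼ^ℓ) ⊆ 𝔪_A B`
  have hJ : ∀ y ∈ J, y ∈ (maximalIdeal A • ⊤ : Submodule A B) := by
    intro y hy
    obtain ⟨c, rfl⟩ := (Submodule.mem_span_range_iff_exists_fun B).mp hy
    refine Submodule.sum_mem _ fun j _ => ?_
    have hjA : x j ^ ℓ ∈ A := pow_mem_fixed σ A hA ζ hζℓ x t hx j
    have hjm : (⟨x j ^ ℓ, hjA⟩ : A) ∈ maximalIdeal A := by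
      rw [mem_maximalIdeal_fixed_iff σ A hA]
      exact Ideal.pow_mem_of_mem _ (hxm j) _ hℓpos
    rw [smul_eq_mul, mul_comm]
    exact Submodule.smul_mem_smul hjm (Submodule.mem_top : c j ∈ (⊤ : Submodule A B))
  -- Step 4: Nakayama
  have htop : (⊤ : Submodule A B) ≤ Submodule.span A (mon '' {v | ∀ j, v j < N}) := by
    refine Submodule.le_of_le_smul_of_le_jacobson_bot (I := maximalIdeal A) Module.Finite.fg_top ?_ ?_
    · rw [IsLocalRing.jacobson_eq_maximalIdeal ⊥ bot_ne_top]
    · rintro b -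
      obtain ⟨b', hb', hdiff⟩ := hbox N b
      have : b = b' + (b - b') := by ring
      rw [this]
      exact Submodule.add_mem_sup hb' (hJ _ (hN hdiff))
  -- Step 5: reduce exponents modulo `ℓ`
  refine eq_top_iff.mpr (htop.trans (Submodule.span_le.mpr ?_))
  rintro _ ⟨v, -, rfl⟩
  have hsplit : mon v = (∏ j, (x j ^ ℓ) ^ (v j / ℓ)) * mon (fun j => v j % ℓ) := by
    simp only [hmon, ← Finset.prod_mul_distrib]
    refine Finset.prod_congr rfl fun j _ => ?_
    rw [← pow_mul, ← pow_add, Nat.div_add_mod (v j) ℓ]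
  have hcA : (∏ j, (x j ^ ℓ) ^ (v j / ℓ)) ∈ A :=
    Subring.prod_mem _ fun j _ => Subring.pow_mem _ (pow_mem_fixed σ A hA ζ hζℓ x t hx j) _
  rw [hsplit]
  exact Submodule.smul_mem _ (⟨_, hcA⟩ : A)
    (Submodule.subset_span ⟨fun j => v j % ℓ, fun j => Nat.mod_lt _ hℓpos, rfl⟩)

include hA hℓ0 hσℓ hℓu hσζ hζℓ hζu hx in
/-- **A weight-`k` eigenvector is an `A`-combination of the weight-`k` monomials `x^v`,
`v ∈ [0,ℓ)^d`, `t·v ≡ k (mod ℓ)`** (same setting as `span_monomials_eq_top_of_eigen`): write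
`b = ∑ a_v x^v` and apply the twisted Reynolds operator `P_k = ∑ᵢ ζ^{−ki} σⁱ`, which multiplies
`x^v` by `ℓ` or `0` according as `t·v ≡ k` or not ([CoP1] (29)–(30): the eigen-decomposition of the
diagonal action). [cite: CossartPiltant2008, Prop. 6.2 (2) (28)–(30) and proof of Lemma 9.4 (HAL pp. 19, 29)] -/
theorem eigen_mem_span_monomials [IsLocalRing B] [IsNoetherianRing B]
    (hres : ∀ b : B, σ b - b ∈ maximalIdeal B)
    (hspan : Ideal.span (Set.range x) = maximalIdeal B) {k : ℕ} {b : B}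
    (hb : σ b = ζ ^ k * b) :
    b ∈ Submodule.span A ((fun v : Fin d → ℕ => ∏ j, x j ^ v j) ''
      {v | (∀ j, v j < ℓ) ∧ (∑ j, t j * v j) % ℓ = k % ℓ}) := by
  classical
  have hℓpos : 0 < ℓ := Nat.pos_of_ne_zero hℓ0
  set mon : (Fin d → ℕ) → B := fun v => ∏ j, x j ^ v j with hmon
  -- `η = ζ⁻¹` and `u = ℓ⁻¹`
  set η : B := ζ ^ (ℓ - 1) with hηdef
  have hηζ : η * ζ = 1 := by rw [hηdef, ← pow_succ, Nat.sub_add_cancel hℓpos, hζℓ]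
  obtain ⟨u, hu⟩ := hℓu.exists_left_inv
  have hσu : σ u = u := by
    have h1 : σ u * (ℓ : B) = 1 := by
      have := congrArg σ hu
      rwa [map_mul, map_natCast, map_one] at this
    calc σ u = σ u * ((ℓ : B) * u) := by rw [mul_comm (ℓ : B), hu, mul_one]
      _ = (σ u * (ℓ : B)) * u := by ring
      _ = u := by rw [h1, one_mul]
  have huA : u ∈ A := (hA u).mpr hσu
  -- the finite box of exponents
  let box : Finset (Fin d → ℕ) := Fintype.piFinset fun _ : Fin d => Finset.range ℓ
  have hboxmem : ∀ v, v ∈ box ↔ ∀ j, v j < ℓ := fun v => by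
    simp only [box, Fintype.mem_piFinset, Finset.mem_range]
  let S : Finset B := box.image mon
  have hS : (mon '' {v | ∀ j, v j < ℓ}) = (S : Set B) := by
    ext y
    simp only [Set.mem_image, Set.mem_setOf_eq, S, Finset.coe_image, Finset.mem_coe, hboxmem]
  have hbS : b ∈ Submodule.span A (S : Set B) := by
    rw [← hS, span_monomials_eq_top_of_eigen σ A hA hℓ0 hσℓ hℓu ζ hσζ hζℓ hζu x t hx hres hspan]
    exact Submodule.mem_top
  obtain ⟨f, -, hf⟩ := Submodule.mem_span_finset.mp hbS
  have hpre : ∀ y ∈ S, ∃ v, v ∈ box ∧ mon v = y := fun y hy => by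
    obtain ⟨v, hv, hvy⟩ := Finset.mem_image.mp hy
    exact ⟨v, hv, hvy⟩
  choose! vOf hvbox hvmon using hpre
  -- the twisted Reynolds operator `P_k`
  let P : B → B := fun c => ∑ i ∈ Finset.range ℓ, η ^ (k * i) * (σ ^ i) c
  have hPsum : ∀ (g : B → B), P (∑ y ∈ S, g y) = ∑ y ∈ S, P (g y) := fun g => by
    simp only [P, map_sum, Finset.mul_sum]
    rw [Finset.sum_comm]
  have hPA : ∀ (a : A) (c : B), P ((a : B) * c) = (a : B) * P c := fun a c => by
    simp only [P, Finset.mul_sum, map_mul]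
    refine Finset.sum_congr rfl fun i _ => ?_
    have : (σ ^ i) (a : B) = (a : B) := by
      have h := pow_apply_eigen' σ hσζ (k := 0) (e := (a : B)) (by rw [pow_zero, one_mul]; exact (hA _).mp a.2) i
      rwa [zero_mul, pow_zero, one_mul] at h
    rw [this]; ring
  have hPy : ∀ y ∈ S, P y =
      (if (∑ j, t j * vOf y j) % ℓ = k % ℓ then (ℓ : B) else 0) * y := fun y hy => by
    have he' : σ (mon (vOf y)) = ζ ^ (∑ j, t j * vOf y j) * mon (vOf y) :=
      apply_monomial σ ζ x t hx (vOf y)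
    have he : σ y = ζ ^ (∑ j, t j * vOf y j) * y := by
      have hyv : mon (vOf y) = y := hvmon y hy
      rwa [hyv] at he'
    change (∑ i ∈ Finset.range ℓ, η ^ (k * i) * (σ ^ i) y) = _
    rw [twistedSum_eigen σ hσζ he k, charSum_eq hℓ0 hηζ hζℓ hζu]
  have hPb : P b = (ℓ : B) * b := by
    change (∑ i ∈ Finset.range ℓ, η ^ (k * i) * (σ ^ i) b) = _
    rw [twistedSum_eigen σ hσζ hb k, charSum_eq hℓ0 hηζ hζℓ hζu, if_pos rfl]
  -- `b = u P_k b = ∑_y u f_y P_k y`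
  have hb' : b = (⟨u, huA⟩ : A) • P b := by
    change b = u * P b
    rw [hPb, ← mul_assoc, hu, one_mul]
  rw [hb']
  refine Submodule.smul_mem _ _ ?_
  rw [← hf, hPsum]
  refine Submodule.sum_mem _ fun y hy => ?_
  rw [Algebra.smul_def, show algebraMap A B (f y) = (f y : B) from rfl, hPA, hPy y hy]
  split_ifs with hcond
  · -- a weight-`k` monomial
    have hymem : y ∈ Submodule.span A (mon '' {v | (∀ j, v j < ℓ) ∧ (∑ j, t j * v j) % ℓ = k % ℓ}) :=
      Submodule.subset_span ⟨vOf y, ⟨(hboxmem _).mp (hvbox y hy), hcond⟩, hvmon y hy⟩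
    have : (f y : B) * ((ℓ : B) * y) = ((f y * (ℓ : A) : A) : B) • y := by
      simp [smul_eq_mul, mul_assoc]
    rw [this]
    exact Submodule.smul_mem _ _ hymem
  · simp

include hA hℓ0 hσℓ hℓu hσζ hζℓ hζu hx in
/-- **The maximal ideal of the ring of invariants is generated by the invariant monomials**
`x^w`, `0 ≠ w ∈ [0,ℓ]^d`, `t·w ≡ 0 (mod ℓ)` — the toric structure of the fixed ring of a diagonal
tame cyclic action ([CoP1] proof of Lemma 9.4: after the diagonalisation (29)–(30) and the monomial
change (53)–(54), "`Ŝ₁^G = κ(S₁)[[z₁^l, z₂, z₃]]`"; here the general diagonal case, algebraic: for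
`a ∈ 𝔪_A ⊆ 𝔪_B` write `a = ∑ⱼ xⱼ cⱼ`, expand `cⱼ` in monomials over `A`, and apply the Reynolds
operator `P₀`, which keeps exactly the invariant monomials `xⱼ x^v`).
[cite: CossartPiltant2008, Prop. 6.2 (2) (28)–(30) and proof of Lemma 9.4 (53)–(54) (HAL pp. 19, 29)] -/
theorem maximalIdeal_fixedSubring_eq_span_monomials [IsLocalRing B] [IsNoetherianRing B]
    (hres : ∀ b : B, σ b - b ∈ maximalIdeal B)
    (hspan : Ideal.span (Set.range x) = maximalIdeal B) :
    (haveI := isLocalRing_fixedSubring σ A hA; maximalIdeal A) =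
      Ideal.span {a : A | ∃ w : Fin d → ℕ, (∀ j, w j ≤ ℓ) ∧ w ≠ 0 ∧
        (∑ j, t j * w j) % ℓ = 0 ∧ (a : B) = ∏ j, x j ^ w j} := by
  classical
  haveI : IsLocalRing A := isLocalRing_fixedSubring σ A hA
  have hℓpos : 0 < ℓ := Nat.pos_of_ne_zero hℓ0
  set mon : (Fin d → ℕ) → B := fun v => ∏ j, x j ^ v j with hmon
  have hxm : ∀ j, x j ∈ maximalIdeal B := fun j => hspan ▸ Ideal.subset_span ⟨j, rfl⟩
  set G : Set A := {a : A | ∃ w : Fin d → ℕ, (∀ j, w j ≤ ℓ) ∧ w ≠ 0 ∧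
    (∑ j, t j * w j) % ℓ = 0 ∧ (a : B) = mon w} with hG
  apply le_antisymm
  swap
  · -- the invariant monomials with `w ≠ 0` lie in `𝔪_A`
    rw [Ideal.span_le]
    rintro a ⟨w, -, hw0, -, haw⟩
    rw [SetLike.mem_coe, mem_maximalIdeal_fixed_iff σ A hA, haw]
    obtain ⟨j, hj⟩ : ∃ j, w j ≠ 0 := by
      by_contra h
      exact hw0 (funext fun i => not_ne_iff.mp (not_exists.mp h i))
    have : x j ^ w j ∣ mon w := Finset.dvd_prod_of_mem (fun i => x i ^ w i) (Finset.mem_univ j)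
    exact Ideal.mem_of_dvd _ this (Ideal.pow_mem_of_mem _ (hxm j) _ (Nat.pos_of_ne_zero hj))
  · intro a ha
    -- `η = ζ⁻¹`, `u = ℓ⁻¹ ∈ A`
    set η : B := ζ ^ (ℓ - 1) with hηdef
    have hηζ : η * ζ = 1 := by rw [hηdef, ← pow_succ, Nat.sub_add_cancel hℓpos, hζℓ]
    obtain ⟨u, hu⟩ := hℓu.exists_left_inv
    have hσu : σ u = u := by
      have h1 : σ u * (ℓ : B) = 1 := by
        have := congrArg σ hu
        rwa [map_mul, map_natCast, map_one] at this
      calc σ u = σ u * ((ℓ : B) * u) := by rw [mul_comm (ℓ : B), hu, mul_one]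
        _ = (σ u * (ℓ : B)) * u := by ring
        _ = u := by rw [h1, one_mul]
    have huA : u ∈ A := (hA u).mpr hσu
    -- the box and the monomial generators of `B` over `A`
    let box : Finset (Fin d → ℕ) := Fintype.piFinset fun _ : Fin d => Finset.range ℓ
    have hboxmem : ∀ v, v ∈ box ↔ ∀ j, v j < ℓ := fun v => by
      simp only [box, Fintype.mem_piFinset, Finset.mem_range]
    let S : Finset B := box.image mon
    have hS : (mon '' {v | ∀ j, v j < ℓ}) = (S : Set B) := by
      ext y
      simp only [Set.mem_image, Set.mem_setOf_eq, S, Finset.coe_image, Finset.mem_coe, hboxmem]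
    have htop : ∀ c : B, c ∈ Submodule.span A (S : Set B) := fun c => by
      rw [← hS, span_monomials_eq_top_of_eigen σ A hA hℓ0 hσℓ hℓu ζ hσζ hζℓ hζu x t hx hres hspan]
      exact Submodule.mem_top
    have hpre : ∀ y ∈ S, ∃ v, v ∈ box ∧ mon v = y := fun y hy => by
      obtain ⟨v, hv, hvy⟩ := Finset.mem_image.mp hy
      exact ⟨v, hv, hvy⟩
    choose! vOf hvbox hvmon using hpre
    -- multiplication by `xⱼ` shifts exponents
    have hmul : ∀ (j : Fin d) (v : Fin d → ℕ), x j * mon v = mon (v + Pi.single j 1) := by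
      intro j v
      simp only [hmon, Pi.add_apply, pow_add, Finset.prod_mul_distrib]
      rw [mul_comm]
      congr 1
      rw [Finset.prod_eq_single j (fun i _ hij => by rw [Pi.single_eq_of_ne hij, pow_zero])
        (fun h => absurd (Finset.mem_univ j) h)]
      simp
    -- write `a = ∑ⱼ xⱼ cⱼ`, `cⱼ = ∑_y f j y • y`
    have haB : (a : B) ∈ Ideal.span (Set.range x) := by
      rw [hspan]; exact (mem_maximalIdeal_fixed_iff σ A hA a).mp ha
    obtain ⟨c, hc⟩ := (Submodule.mem_span_range_iff_exists_fun B).mp haB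
    have hcf : ∀ j, ∃ f : B → A, ∑ y ∈ S, f y • y = c j := fun j => by
      obtain ⟨f, -, hf⟩ := Submodule.mem_span_finset.mp (htop (c j))
      exact ⟨f, hf⟩
    choose f hf using hcf
    -- the Reynolds operator `P₀`, with values in `A`
    let P : B → B := fun c => ∑ i ∈ Finset.range ℓ, (σ ^ i) c
    have hPfix : ∀ c, σ (P c) = P c := fun c => apply_sum_pow_apply' σ hℓ0 hσℓ c
    have hPsum : ∀ (T : Finset B) (g : B → B), P (∑ y ∈ T, g y) = ∑ y ∈ T, P (g y) := fun T g => by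
      simp only [P, map_sum]
      rw [Finset.sum_comm]
    have hPsum' : ∀ (g : Fin d → B), P (∑ j, g j) = ∑ j, P (g j) := fun g => by
      simp only [P, map_sum]
      rw [Finset.sum_comm]
    have hPA : ∀ (a' : A) (c : B), P ((a' : B) * c) = (a' : B) * P c := fun a' c => by
      simp only [P, Finset.mul_sum, map_mul]
      refine Finset.sum_congr rfl fun i _ => ?_
      have h := pow_apply_eigen' σ hσζ (k := 0) (e := (a' : B))
        (by rw [pow_zero, one_mul]; exact (hA _).mp a'.2) i
      rw [zero_mul, pow_zero, one_mul] at h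
      rw [h]
    have hPmon : ∀ w : Fin d → ℕ, P (mon w) =
        (if (∑ j, t j * w j) % ℓ = 0 then (ℓ : B) else 0) * mon w := fun w => by
      have he : σ (mon w) = ζ ^ (∑ j, t j * w j) * mon w := apply_monomial σ ζ x t hx w
      have h := twistedSum_eigen σ (ℓ := ℓ) (η := η) hσζ he 0
      have h2 := charSum_eq hℓ0 hηζ hζℓ hζu 0 (∑ j, t j * w j)
      simp only [zero_mul, pow_zero, one_mul, Nat.zero_mod] at h h2
      change (∑ i ∈ Finset.range ℓ, (σ ^ i) (mon w)) = _
      rw [h, h2]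
      congr
    have hPa : P (a : B) = (ℓ : B) * (a : B) := by
      have h1 : ∀ i ∈ Finset.range ℓ, (σ ^ i) (a : B) = (a : B) := fun i _ => by
        have h := pow_apply_eigen' σ hσζ (k := 0) (e := (a : B))
          (by rw [pow_zero, one_mul]; exact (hA _).mp a.2) i
        rwa [zero_mul, pow_zero, one_mul] at h
      change (∑ i ∈ Finset.range ℓ, (σ ^ i) (a : B)) = _
      rw [Finset.sum_congr rfl h1, Finset.sum_const, Finset.card_range, nsmul_eq_mul]
    -- the generators `g j y := P (xⱼ y) ∈ A`, which lie in `span G`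
    let g : Fin d → B → A := fun j y => ⟨P (x j * y), (hA _).mpr (hPfix _)⟩
    have hgspan : ∀ j, ∀ y ∈ S, g j y ∈ Ideal.span G := by
      intro j y hy
      have hw : x j * y = mon (vOf y + Pi.single j 1) := by rw [← hmul j (vOf y), hvmon y hy]
      set w : Fin d → ℕ := vOf y + Pi.single j 1 with hwdef
      by_cases hcond : (∑ i, t i * w i) % ℓ = 0
      · have hwA : mon w ∈ A := monomial_mem_fixed_of_mod σ A hA ζ hζℓ x t hx hcond
        have hgen : (⟨mon w, hwA⟩ : A) ∈ G := by
          refine ⟨w, fun i => ?_, ?_, hcond, rfl⟩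
          · have hvi : vOf y i < ℓ := (hboxmem _).mp (hvbox y hy) i
            by_cases hij : i = j
            · subst hij; simp only [hwdef, Pi.add_apply, Pi.single_eq_same]; omega
            · simp only [hwdef, Pi.add_apply, Pi.single_eq_of_ne hij, add_zero]; omega
          · intro hw0
            have := congrFun hw0 j
            simp [hwdef] at this
        have hgeq : g j y = (ℓ : A) * ⟨mon w, hwA⟩ := by
          apply Subtype.ext
          change P (x j * y) = (ℓ : B) * mon w
          rw [hw, hPmon, if_pos hcond]
        rw [hgeq]
        exact Ideal.mul_mem_left _ _ (Ideal.subset_span hgen)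
      · have hgeq : g j y = 0 := by
          apply Subtype.ext
          change P (x j * y) = 0
          rw [hw, hPmon, if_neg hcond, zero_mul]
        rw [hgeq]
        exact Ideal.zero_mem _
    -- `a = u ∑ⱼ ∑_y f j y · g j y`
    have hkey : a = (⟨u, huA⟩ : A) * ∑ j, ∑ y ∈ S, f j y * g j y := by
      apply Subtype.ext
      simp only [Subring.coe_mul, AddSubmonoidClass.coe_finsetSum]
      change (a : B) = u * ∑ j, ∑ y ∈ S, (f j y : B) * P (x j * y)
      have h1 : (a : B) = ∑ j, ∑ y ∈ S, (f j y : B) * (x j * y) := by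
        rw [← hc]
        refine Finset.sum_congr rfl fun j _ => ?_
        rw [smul_eq_mul, ← hf j, Finset.sum_mul]
        refine Finset.sum_congr rfl fun y _ => ?_
        rw [Algebra.smul_def]
        change ((f j y : A) : B) * y * x j = (f j y : B) * (x j * y)
        ring
      have h2 : P (a : B) = ∑ j, ∑ y ∈ S, (f j y : B) * P (x j * y) := by
        conv_lhs => rw [h1]
        rw [hPsum']
        refine Finset.sum_congr rfl fun j _ => ?_
        rw [hPsum]
        refine Finset.sum_congr rfl fun y _ => ?_
        exact hPA (f j y) _
      rw [← h2, hPa, ← mul_assoc, hu, one_mul]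
    rw [hkey]
    refine Ideal.mul_mem_left _ _ (Ideal.sum_mem _ fun j _ => Ideal.sum_mem _ fun y hy => ?_)
    exact Ideal.mul_mem_left _ _ (hgspan j y hy)

end Monomial

end Literature.AlgebraicGeometry.Resolution

end
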